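import Summits.QuantumFields.BalabanUV.T4Continuum.Support.ShellMeasureScalingSU2
import Summits.QuantumFields.BalabanUV.T4Continuum.Support.ShellMeasureTranslateBond

/-!
# `T4Continuum.ShellMeasureHeadlines` — the two typed members of the NE7c shell-measure frame in INSTANTIABLE form:
# (γ_loc) for `G = SU(2)` stated for a GAUGE-INVARIANT pair through the tree gauge, the CAUCHY form of the (S-ii)
# sizing criterion, and member (τ)'s headline with the grid parameters removed
# (cell `pub-balaban`, sub-cell `t4`, spine estimate NE7c (node U5b); lineage t4-ne7c-p1 = PROVER seat P1
# «shell-measure route», generation 22; the record's optional kernel tasks §5 (xlvi)(a), (xlvi)(c), (xlix)(d), each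
# once; tree target `Summits/QuantumFields/BalabanUV/T4Continuum/Support/`; ADDITIVE — imports two tree modules and
# modifies nothing)

HONEST FRAMING.  Finite four-torus programme, rung (B)+1 only — NOT infinite volume, NOT a mass gap, NOT the Clay
problem, NOT summit progress; (B), `BetaPertHyp`, (B^μ) are not mentioned because nothing here consumes them.  The
cell wall of NE7c — (M1) `T4ShellMeasure.SlotAntiConcentration` FOR BAŁABAN'S INDUCTIVELY DEFINED EFFECTIVE MEASURES —
is NOT PRINTED in [Balaban 1983–89] (GAPS G-ne7cp1-1), asserted by nobody, and NOT moved by this file.  Every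
declaration is [folklore] kernel mathematics (a composition of two tree theorems, one Cauchy estimate, one limit),
0 sorry, 0 citations; NOTHING of Bałaban's densities, minimisers or response kernels is asserted.

THE POINTS.
* §1 (γ_loc) FOR A GAUGE-INVARIANT PAIR.  `ShellMeasureScalingSU2.slotAntiConcentration_realized_su2_of_coreMap`
  asks the WINDOW FACTORISATION `F(V[Λ := y]) = χ_{Λ,cV,S}(y)·R V y` of the realized density over the chart bonds
  `Λ`.  A gauge-INVARIANT `F` never factorises through a proper window over all bonds of a block (a one-site gauge
  transformation inside the block moves a bond variable out of the window without changing `F`), so for the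
  physical pair `(F, u)` the hypothesis must be asked IN THE TREE GAUGE: of `F ∘ fixTo T U₀` (`T` loop-free, the
  spanning tree of the block's sites; `T4TreeGaugeFixing`), with chart bonds `Λ` AVOIDING `T` (else `F ∘ fixTo T U₀`
  does not depend on the `Λ ∩ T` coordinates and a proper window again forces `F ∘ fixTo T U₀ = 0` — the statement
  stays true but is vacuous).  `slotAntiConcentration_realized_su2_gaugeInvariant` is that composition with
  `ShellMeasureScalingLocal.slotAntiConcentration_gaugeFixed_iff`; `fixTo_updateFinset_of_disjoint` is the
  dictionary line «the block sections of `F ∘ fixTo T U₀` are the block sections of `F` at the tree-gauged exterior»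
  for `Λ` disjoint from `T`.  This is the realized statement whose window factorisation IS instantiable by a
  small-field weight after an axial gauge (located reading (LR), `T4ShellMeasureLocal`); no instance is built here.
* §2 THE CAUCHY FORM OF CRITERION (ii′).  `ShellMeasureScalingLocal.fwdLogLipschitzOn_rayWeight_of_deriv_ge_affine`
  sizes the ray-weight loss (S-ii) by `B_f = (ℓ + C x₀^m)·x₀` from a LOWER bound `S′ ≥ −(ℓ + C z^m)` on the
  derivative of the sectioned ray action (`ℓ_j` = the block's linear response to the frozen exterior, GAPS
  G-ne7cp1-22 — located, NOT PRINTED).  If the sectioned ray action is the real part of the restriction of a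
  function `f` complex differentiable and bounded by `H` on the disc `‖w‖ < R`, `x₀ < R` — an analyticity–boundedness
  pair of the TYPE printed for Bałaban's effective actions and minimisers (B12 Thm 1, B11 Prop. 9 — cell numbering;
  the pair for the SECTIONED action along the ray is NOT PRINTED) — then Cauchy gives `|S′| ≤ 3H/(R − x₀)` on
  `[−x₀, x₀]` (`T4ShellMeasureAnalytic.cauchy_bounds_on_segment`) and criterion (ii′) fires with `ℓ = 3H/(R − x₀)`,
  `C = 0`: `B_f = 3H·x₀/(R − x₀)` (`fwdLogLipschitzOn_rayWeight_of_analytic`, one-depth form `rayLoss_of_analytic`).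
  So (S-ii)'s sizing input has the same printed TYPE as (AN-bound) of GAPS G-ne7cp1-8a; nothing is discharged.
* §3 MEMBER (τ) GRID-FREE.  `ShellMeasureTranslateBond.slotAntiConcentration_realized_oneBond` carries the grid mesh
  `δ` and the number of translates `k` in its constant `D = |M|·(e^{Λ(ℓ+w)}·(⌊ℓ/δ⌋+1)/k)/ρ`, `ℓ = 2ρθ/κ`.  Running it
  on the grids `δ = (ℓ+w)/n`, `k = n` and letting `n → ∞` (`ge_of_tendsto`; the degenerate cases `M = ∅` or `θ = 0`
  have an empty shell) gives the constant `D = |M|·e^{Λ(ℓ+w)}·(2θ/κ)/(ℓ + w)` for any window `w > 0` — i.e.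
  `D·ρ = |M|·e^{Λ(ℓ+w)}·ℓ/(ℓ+w) ≤ |M|·e^{Λ(ℓ+w)}·2ρθ/(κw)`, the memo's `D_k`, with no auxiliary parameter left
  (`slotAntiConcentration_realized_oneBond_gridFree`).

WHAT THIS DOES NOT DO.  No instance of the window factorisation, of (S-i)/(S-ii), of the analyticity pair `(R, H)`
for a sectioned action, or of (T1-lin)/(T1-loc)/(T1-size)/(T2)/(T4) for Bałaban's localized minimisers ∕ block
weights is constructed; (Det), (LR), (MR), (W1), the (F∞)-rate keep their status.  NE7c NOT proved.
-/

namespace Summit.QuantumFields.BalabanUV.T4Continuum.ShellMeasureHeadlines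

open MeasureTheory Set Function Metric
open scoped ENNReal
open Literature.MathematicalPhysics.QuantumFieldTheory.Balaban1983to89
open T4ShellMeasure (SlotAntiConcentration)
open T4ShellMeasureAnalytic (FwdLogLipschitzOn cauchy_bounds_on_segment)

/-! ## §1 (γ_loc) for `G = SU(2)`, stated for a gauge-invariant pair through the tree gauge -/

section GaugeInvariantPair

open GaugeField (GaugeInvariant)
open T4TreeGaugeFixing (NoClosedLoop fixTo measurable_fixTo)
open T4CubePoincare (cube)
open T4CubeChartGnomonic (SU2)
open T4CubeChartExp (expWindowDensity expFibreChart)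
open T4ShellMeasureDet (blockLaw)
open ShellMeasureScalingLocal (slotAntiConcentration_gaugeFixed_iff)
open ShellMeasureScalingSU2 (slotAntiConcentration_realized_su2_of_coreMap)

variable {P : Params} {j : ℕ} [DecidableEq (PBond P j)]

/-- DICTIONARY: for chart bonds `Λ` DISJOINT from the tree `T`, the block section of the tree-gauged density at
exterior `V` is the block section of the density itself at the tree-gauged exterior `V[T := U₀]`:
`(V[Λ := y])[T := U₀] = (V[T := U₀])[Λ := y]`. [folklore] -/
theorem fixTo_updateFinset_of_disjoint {G : Type*} {T Λ : Finset (PBond P j)} (h : Disjoint Λ T)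
    (U₀ V : GaugeField P j G) (y : ↥Λ → G) :
    fixTo T U₀ (updateFinset V Λ y) = updateFinset (fixTo T U₀ V) Λ y := by
  funext b
  by_cases hb : b ∈ Λ
  · have hbT : b ∉ T := Finset.disjoint_left.1 h hb
    simp only [fixTo, updateFinset, hb, hbT, dif_pos, if_false]
  · by_cases hbT : b ∈ T
    · simp only [fixTo, updateFinset, hb, hbT, dif_neg, if_true, not_false_eq_true]
    · simp only [fixTo, updateFinset, hb, hbT, dif_neg, if_false, not_false_eq_true]

/-- **(γ_loc) FOR `G = SU(2)` AND A GAUGE-INVARIANT PAIR, THROUGH THE TREE GAUGE.**  Data: a loop-free bond set `T`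
with prescribed values `U₀` (the tree gauge `U ↦ U[T := U₀]` of `T4TreeGaugeFixing`); chart bonds `Λ` (to be taken
DISJOINT from `T` — see the module docstring; not needed for the proof) with an enumeration `e` of the `n = 3·#Λ`
chart coordinates; a window half-side `S` (`0 < S`, `3S² < π²`); per exterior `V` a chart centre `c V` and a
measurable block weight `R V`; a GAUGE-INVARIANT measurable realized density `F` and a GAUGE-INVARIANT measurable
tested variable `u`.  HYPOTHESES — all asked of the TREE-GAUGED pair `(F ∘ fixTo T U₀, u ∘ fixTo T U₀)`: the window
factorisation `hFw`, per-section finiteness `hfin`, and the analytic hypotheses (S-i) `hcore`, (S-ii) `hden` of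
`ShellMeasureScalingSU2.slotAntiConcentration_realized_su2_of_coreMap` (block weight ALONE; Jacobian and window ride
free); numbers `θ, ρ ≥ 0`, depth `a ≥ 0`, `B_f`, `D` with `(n + B_f)·a ≤ D·ρ`.  CONCLUSION: (M1)
`SlotAntiConcentration ((fieldMeasure P j SU2).withDensity F) u θ ρ D` for the ORIGINAL pair — the SU(2) headline
for the gauged pair transported back by `ShellMeasureScalingLocal.slotAntiConcentration_gaugeFixed_iff`.  Located,
NOT PRINTED: every hypothesis, as instances for Bałaban's block weights. [folklore] -/
theorem slotAntiConcentration_realized_su2_gaugeInvariant {T : Finset (PBond P j)} (hT : NoClosedLoop T)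
    (U₀ : GaugeField P j SU2) (Λ : Finset (PBond P j)) {n : ℕ} (e : ↥Λ × Fin 3 ≃ Fin n)
    {S : ℝ} (hS : 0 < S) (hSπ : 3 * S ^ 2 < Real.pi ^ 2) (c : GaugeField P j SU2 → GaugeField P j SU2)
    {R : GaugeField P j SU2 → (↥Λ → SU2) → ℝ≥0∞} (hR : ∀ V, Measurable (R V))
    {F : GaugeField P j SU2 → ℝ≥0∞} (hF : Measurable F) (hFi : GaugeInvariant F)
    (hFw : ∀ V y, F (fixTo T U₀ (updateFinset V Λ y)) =
      ENNReal.ofReal (expWindowDensity Λ (c V) S (updateFinset (c V) Λ y)) * R V y)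
    (hfin : ∀ V, ((blockLaw Λ).withDensity fun y => F (fixTo T U₀ (updateFinset V Λ y))) univ ≠ ∞)
    {u : GaugeField P j SU2 → ℝ} (hu : Measurable u) (hui : GaugeInvariant u)
    {θ ρ a Bf D : ℝ} (hθ : 0 ≤ θ) (hρ : 0 ≤ ρ) (ha : 0 ≤ a) (haD : ((n : ℝ) + Bf) * a ≤ D * ρ)
    (hcore : ∀ V x, x ∈ cube n S → R V (expFibreChart Λ (c V) e x) ≠ 0 →
      u (fixTo T U₀ (updateFinset V Λ (expFibreChart Λ (c V) e x))) < θ →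
      u (fixTo T U₀ (updateFinset V Λ (expFibreChart Λ (c V) e (Real.exp (-a) • x)))) < θ * (1 - ρ))
    (hden : ∀ V x, x ∈ cube n S → R V (expFibreChart Λ (c V) e x) ≠ 0 →
      u (fixTo T U₀ (updateFinset V Λ (expFibreChart Λ (c V) e x))) < θ →
      R V (expFibreChart Λ (c V) e x) ≤
        ENNReal.ofReal (Real.exp (Bf * a)) * R V (expFibreChart Λ (c V) e (Real.exp (-a) • x))) :
    SlotAntiConcentration ((fieldMeasure P j SU2).withDensity F) u θ ρ D :=
  (slotAntiConcentration_gaugeFixed_iff hT U₀ hF hFi hu hui).1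
    (slotAntiConcentration_realized_su2_of_coreMap Λ e hS hSπ c hR (hF.comp (measurable_fixTo T U₀)) hFw hfin
      (hu.comp (measurable_fixTo T U₀)) hθ hρ ha haD hcore hden)

end GaugeInvariantPair

/-! ## §2 The Cauchy form of criterion (ii′): (S-ii)'s sizing from an analyticity–boundedness pair -/

section CauchyForm

open ShellMeasureScalingLocal (fwdLogLipschitzOn_rayWeight_of_deriv_ge_affine rayLoss_of_fwdLogLipschitzOn)

/-- **CRITERION (ii′) FROM AN ANALYTICITY–BOUNDEDNESS PAIR.**  If the sectioned block action along the ray is the real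
part of the restriction of `f : ℂ → ℂ`, complex differentiable with `‖f‖ ≤ H` on the disc `‖w‖ < R`, and
`0 < x₀ < R`, then the Boltzmann ray weight `r ↦ e^{−Re f(e^{−r})}` is forward log-Lipschitz with constant
`B_f = (3H/(R − x₀))·x₀` on every `W ⊆ [−log x₀, ∞)`: the Cauchy estimate `|f′| ≤ 3H/(R − x₀)` on `[−x₀, x₀]`
(`T4ShellMeasureAnalytic.cauchy_bounds_on_segment`) is the lower bound `S′ ≥ −ℓ`, `ℓ = 3H/(R − x₀)`, `C = 0` of
`ShellMeasureScalingLocal.fwdLogLipschitzOn_rayWeight_of_deriv_ge_affine`.  The pair `(R, H)` for a sectioned action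
of Bałaban's is located, NOT PRINTED (printed TYPE: B12 Thm 1, B11 Prop. 9 = (AN-bound) of GAPS G-ne7cp1-8a).
[folklore] -/
theorem fwdLogLipschitzOn_rayWeight_of_analytic {f : ℂ → ℂ} {R H x₀ : ℝ} (hx₀ : 0 < x₀) (hR : x₀ < R)
    (hf : DifferentiableOn ℂ f (ball 0 R)) (hH : ∀ w ∈ ball (0 : ℂ) R, ‖f w‖ ≤ H)
    {W : Set ℝ} (hW : W ⊆ Ici (-Real.log x₀)) :
    FwdLogLipschitzOn (fun r => ENNReal.ofReal (Real.exp (-(f (Real.exp (-r))).re))) (3 * H / (R - x₀) * x₀) W := by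
  have hH0 : 0 ≤ H := (norm_nonneg _).trans (hH 0 (mem_ball_self (hx₀.trans hR)))
  have hℓ : 0 ≤ 3 * H / (R - x₀) := div_nonneg (by positivity) (by linarith)
  have hc := cauchy_bounds_on_segment hx₀.le hR hf hH
  have h := fwdLogLipschitzOn_rayWeight_of_deriv_ge_affine (S := fun t : ℝ => (f t).re)
    (S' := fun t : ℝ => (deriv f t).re) (ℓ := 3 * H / (R - x₀)) (C := 0) (m := 0) hℓ le_rfl hx₀
    (fun z hz => ?_) (fun z hz => ?_) hW
  · simpa only [zero_mul, add_zero] using h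
  · -- the real restriction of `f` is differentiable at every `z ∈ (0, x₀]`, derivative `Re f′(z)`
    have hzR : ‖(z : ℂ)‖ < R := by
      rw [Complex.norm_real, Real.norm_eq_abs, abs_of_pos hz.1]; exact hz.2.trans_lt hR
    have hd : HasDerivAt f (deriv f z) (z : ℂ) :=
      (hf.differentiableAt (isOpen_ball.mem_nhds (mem_ball_zero_iff.2 hzR))).hasDerivAt
    exact hd.real_of_complex
  · -- Cauchy: `Re f′(z) ≥ −‖f′(z)‖ ≥ −3H/(R − x₀)`
    have hz' : |z| ≤ x₀ := by rw [abs_of_pos hz.1]; exact hz.2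
    have hb := (hc z hz').2.2.1
    have hre : |(deriv f z).re| ≤ ‖deriv f z‖ := Complex.abs_re_le_norm _
    rw [pow_zero, mul_one, add_zero]
    linarith [(abs_le.1 (hre.trans hb)).1]

/-- the one-depth form consumed by the engine's `hden`: from every point `z ∈ (0, x₀]` of the ray the Boltzmann weight
`e^{−Re f}` loses at most `e^{B_f a}`, `B_f = (3H/(R − x₀))·x₀`, under the contraction by `e^{−a}`, `a ≥ 0`.
[folklore] -/
theorem rayLoss_of_analytic {f : ℂ → ℂ} {R H x₀ : ℝ} (hx₀ : 0 < x₀) (hR : x₀ < R)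
    (hf : DifferentiableOn ℂ f (ball 0 R)) (hH : ∀ w ∈ ball (0 : ℂ) R, ‖f w‖ ≤ H)
    {z : ℝ} (hz : z ∈ Ioc 0 x₀) {a : ℝ} (ha : 0 ≤ a) :
    ENNReal.ofReal (Real.exp (-(f z).re)) ≤
      ENNReal.ofReal (Real.exp (3 * H / (R - x₀) * x₀ * a)) *
        ENNReal.ofReal (Real.exp (-(f ((Real.exp (-a) * z : ℝ) : ℂ)).re)) :=
  rayLoss_of_fwdLogLipschitzOn (w := fun t : ℝ => ENNReal.ofReal (Real.exp (-(f t).re)))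
    (fwdLogLipschitzOn_rayWeight_of_analytic hx₀ hR hf hH subset_rfl) hz ha

/-- NON-VACUITY of §2: the affine action `f(w) = α + β w` (`β` = a linear response to a frozen exterior) on the disc
`‖w‖ < R` with `H = ‖α‖ + ‖β‖ R` gives `B_f = 3(‖α‖ + ‖β‖R)·x₀/(R − x₀)`. [folklore] -/
example (α β : ℂ) {R x₀ : ℝ} (hx₀ : 0 < x₀) (hR : x₀ < R) :
    FwdLogLipschitzOn (fun r => ENNReal.ofReal (Real.exp (-((fun w : ℂ => α + β * w) (Real.exp (-r))).re)))
      (3 * (‖α‖ + ‖β‖ * R) / (R - x₀) * x₀) (Ici (-Real.log x₀)) :=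
  fwdLogLipschitzOn_rayWeight_of_analytic hx₀ hR
    ((differentiable_const α).add ((differentiable_const β).mul differentiable_id)).differentiableOn
    (fun w hw => by
      rw [mem_ball_zero_iff] at hw
      calc ‖α + β * w‖ ≤ ‖α‖ + ‖β * w‖ := norm_add_le _ _
        _ = ‖α‖ + ‖β‖ * ‖w‖ := by rw [norm_mul]
        _ ≤ ‖α‖ + ‖β‖ * R := by gcongr)
    subset_rfl

end CauchyForm

/-! ## §3 Member (τ) with the grid parameters removed -/

section GridFree

open ShellMeasureTranslateBond (bondMul slotAntiConcentration_realized_oneBond)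

/-- limit step: if `x ≤ ofReal(a + A/n)·y` for every `n ≥ 1`, with `a > 0`, then `x ≤ ofReal(a)·y` (the right-hand
sides converge, `ENNReal.Tendsto.mul_const` — no finiteness of `y` needed since `ofReal a ≠ 0`). [folklore] -/
theorem le_mul_of_forall_le_add_div {x y : ℝ≥0∞} {a A : ℝ} (ha : 0 < a)
    (h : ∀ n : ℕ, 0 < n → x ≤ ENNReal.ofReal (a + A / n) * y) : x ≤ ENNReal.ofReal a * y := by
  have ht : Filter.Tendsto (fun n : ℕ => ENNReal.ofReal (a + A / n) * y) Filter.atTop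
      (nhds (ENNReal.ofReal a * y)) := by
    refine ENNReal.Tendsto.mul_const (ENNReal.tendsto_ofReal ?_) (Or.inl (ENNReal.ofReal_pos.2 ha).ne')
    simpa only [add_zero] using tendsto_const_nhds.add (tendsto_const_div_atTop_nhds_zero_nat A)
  exact ge_of_tendsto ht (Filter.eventually_atTop.2 ⟨1, fun n hn => h n hn⟩)

/-- grid arithmetic: with mesh `(ℓ+w)/n` and `n ≥ 1` translates, `(⌊ℓ/((ℓ+w)/n)⌋ + 1)/n ≤ ℓ/(ℓ+w) + 1/n`.
[folklore] -/
theorem grid_ratio_le {ℓ w : ℝ} (hℓ : 0 ≤ ℓ) (hℓw : 0 < ℓ + w) {n : ℕ} (hn : 0 < n) :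
    ((⌊ℓ / ((ℓ + w) / n)⌋₊ + 1 : ℕ) : ℝ) / n ≤ ℓ / (ℓ + w) + 1 / n := by
  have hn' : (0 : ℝ) < n := Nat.cast_pos.2 hn
  have hx : 0 ≤ ℓ / ((ℓ + w) / n) := div_nonneg hℓ (div_nonneg hℓw.le hn'.le)
  have heq : ℓ / ((ℓ + w) / n) = ℓ / (ℓ + w) * n := by
    field_simp
  have hfl : (⌊ℓ / ((ℓ + w) / n)⌋₊ : ℝ) ≤ ℓ / (ℓ + w) * n := (Nat.floor_le hx).trans_eq heq
  push_cast
  rw [div_le_iff₀ hn', add_mul, div_mul_cancel₀ _ hn'.ne']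
  linarith

variable {P : Params} {j : ℕ} {G : Type*} [GaugeGroup G] [MeasurableSpace G] [MeasurableMul₂ G]
  [DecidableEq (PBond P j)] [HaarData G]

/-- **MEMBER (τ) END TO END, GRID-FREE.**  The data and the located analytic binders of
`ShellMeasureTranslateBond.slotAntiConcentration_realized_oneBond` (menu `M`, moved bonds `bd`, one-parameter
subgroups `γ`, pieces `S` covering the shell, the active functional's one-sided expansion `hexp` with `κ > 0`, `C₂`
on `[0, s₁]` ((T1)+(T1′) — after GAPS G-ne7cp1-24: the data-relative rate of `ShellMeasureTranslateRate`), `hact`,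
`hdom`, the window fitting `ℓ + w ≤ s₁`, `C₂(ℓ + w) ≤ κ/2`, `ℓ = 2ρθ/κ`, and the forward log-Lipschitz rate `Λ`
of the realized density along the flow over `[0, ℓ + w]` ((T2)+(T4))) WITHOUT the grid mesh `δ` and the number of
translates `k`, for any window `w > 0`.  CONCLUSION: (M1)
`SlotAntiConcentration ((fieldMeasure P j G).withDensity F) u θ ρ D` with `D = |M|·e^{Λ(ℓ+w)}·(2θ/κ)/(ℓ + w)`,
i.e. `D·ρ = |M|·e^{Λ(ℓ+w)}·ℓ/(ℓ + w)` — the `n → ∞` limit of the gridded constants along `δ = (ℓ+w)/n`, `k = n`.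
[folklore] -/
theorem slotAntiConcentration_realized_oneBond_gridFree {M : Type*} [Fintype M] (bd : M → PBond P j)
    {γ : M → ℝ → G} (hγ : ∀ m s t, γ m (s + t) = γ m s * γ m t) (hγ0 : ∀ m, γ m 0 = 1)
    {F : GaugeField P j G → ℝ≥0∞} (hF : Measurable F) {u : GaugeField P j G → ℝ}
    {θ ρ κ C₂ s₁ w Λ : ℝ} (hθ : 0 ≤ θ) (hρ : 0 < ρ) (hκ : 0 < κ) (hΛ : 0 ≤ Λ) (hw : 0 < w)
    (hws : 2 * ρ * θ / κ + w ≤ s₁) (hwC : C₂ * (2 * ρ * θ / κ + w) ≤ κ / 2) (hC₂ : 0 ≤ C₂)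
    (S : M → Set (GaugeField P j G)) (hSm : ∀ m, MeasurableSet (S m))
    (hSsh : ∀ m, S m ⊆ {x | θ * (1 - ρ) ≤ u x ∧ u x < θ})
    (hcover : {x | θ * (1 - ρ) ≤ u x ∧ u x < θ} ⊆ ⋃ m, S m)
    (gAct : M → GaugeField P j G → ℝ → ℝ) (hact : ∀ m, ∀ x ∈ S m, gAct m x 0 = u x)
    (hdom : ∀ m, ∀ x ∈ S m, ∀ s, gAct m x s ≤ u (bondMul (bd m) (γ m s) x))
    (hexp : ∀ m, ∀ x ∈ S m, ∀ s, 0 ≤ s → s ≤ s₁ → gAct m x 0 + κ * s - C₂ * s ^ 2 ≤ gAct m x s)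
    (hLip : ∀ m, ∀ x ∈ S m, ∀ s, 0 ≤ s → s ≤ 2 * ρ * θ / κ + w →
      F x ≤ ENNReal.ofReal (Real.exp (Λ * s)) * F (bondMul (bd m) (γ m s) x)) :
    SlotAntiConcentration ((fieldMeasure P j G).withDensity F) u θ ρ
      (Fintype.card M * (Real.exp (Λ * (2 * ρ * θ / κ + w)) * (2 * θ / κ) / (2 * ρ * θ / κ + w))) := by
  have hℓ0 : 0 ≤ 2 * ρ * θ / κ := div_nonneg (by positivity) hκ.le
  have hℓw : 0 < 2 * ρ * θ / κ + w := by linarith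
  have hA : 0 ≤ (Fintype.card M : ℝ) * Real.exp (Λ * (2 * ρ * θ / κ + w)) := by positivity
  -- the gridded headline at mesh `(ℓ+w)/n` with `n ≥ 1` translates
  have hgrid : ∀ n : ℕ, 0 < n →
      ((fieldMeasure P j G).withDensity F) {x | θ * (1 - ρ) ≤ u x ∧ u x < θ} ≤
        ENNReal.ofReal ((Fintype.card M : ℝ) * Real.exp (Λ * (2 * ρ * θ / κ + w)) *
            ((2 * ρ * θ / κ) / (2 * ρ * θ / κ + w)) +
          (Fintype.card M : ℝ) * Real.exp (Λ * (2 * ρ * θ / κ + w)) / n) *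
        ((fieldMeasure P j G).withDensity F) univ := by
    intro n hn
    have hn' : (0 : ℝ) < n := Nat.cast_pos.2 hn
    have hδ : 0 < (2 * ρ * θ / κ + w) / n := div_pos hℓw hn'
    have hspan : ((n : ℝ) - 1) * ((2 * ρ * θ / κ + w) / n) ≤ 2 * ρ * θ / κ + w := by
      rw [mul_div_assoc', div_le_iff₀ hn']
      nlinarith
    have h := slotAntiConcentration_realized_oneBond bd hγ hγ0 hF hθ hρ hκ hΛ hδ hn hws hwC hC₂ hspan S hSm
      hSsh hcover gAct hact hdom hexp hLip
    unfold SlotAntiConcentration at h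
    refine h.trans (mul_le_mul' (ENNReal.ofReal_le_ofReal ?_) le_rfl)
    have hr := grid_ratio_le hℓ0 hℓw hn
    rw [Fintype.card_fin, div_mul_cancel₀ _ hρ.ne']
    calc (Fintype.card M : ℝ) * (Real.exp (Λ * (2 * ρ * θ / κ + w)) *
          ((⌊(2 * ρ * θ / κ) / ((2 * ρ * θ / κ + w) / n)⌋₊ + 1 : ℕ) : ℝ) / n)
        = (Fintype.card M : ℝ) * Real.exp (Λ * (2 * ρ * θ / κ + w)) *
          (((⌊(2 * ρ * θ / κ) / ((2 * ρ * θ / κ + w) / n)⌋₊ + 1 : ℕ) : ℝ) / n) := by ring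
      _ ≤ (Fintype.card M : ℝ) * Real.exp (Λ * (2 * ρ * θ / κ + w)) *
          ((2 * ρ * θ / κ) / (2 * ρ * θ / κ + w) + 1 / n) := mul_le_mul_of_nonneg_left hr hA
      _ = _ := by ring
  unfold SlotAntiConcentration
  have hDρ : (Fintype.card M : ℝ) * (Real.exp (Λ * (2 * ρ * θ / κ + w)) * (2 * θ / κ) / (2 * ρ * θ / κ + w)) * ρ =
      (Fintype.card M : ℝ) * Real.exp (Λ * (2 * ρ * θ / κ + w)) * ((2 * ρ * θ / κ) / (2 * ρ * θ / κ + w)) := by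
    field_simp
  rw [hDρ]
  by_cases hpos : 0 < (Fintype.card M : ℝ) * Real.exp (Λ * (2 * ρ * θ / κ + w)) *
      ((2 * ρ * θ / κ) / (2 * ρ * θ / κ + w))
  · exact le_mul_of_forall_le_add_div hpos hgrid
  · -- degenerate: `M = ∅` or `θ = 0`; the shell is empty
    have hzero : (Fintype.card M : ℝ) * Real.exp (Λ * (2 * ρ * θ / κ + w)) *
        ((2 * ρ * θ / κ) / (2 * ρ * θ / κ + w)) = 0 :=
      le_antisymm (not_lt.1 hpos) (mul_nonneg hA (div_nonneg hℓ0 hℓw.le))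
    have hempty : {x | θ * (1 - ρ) ≤ u x ∧ u x < θ} = ∅ := by
      rcases mul_eq_zero.1 hzero with hA0 | hl0
      · have hM : Fintype.card M = 0 := by
          rcases mul_eq_zero.1 hA0 with h0 | h0
          · exact_mod_cast h0
          · exact absurd h0 (Real.exp_pos _).ne'
        haveI : IsEmpty M := Fintype.card_eq_zero_iff.1 hM
        exact eq_empty_of_subset_empty (hcover.trans (by rw [iUnion_of_empty]))
      · have hℓz : 2 * ρ * θ / κ = 0 := by
          rcases div_eq_zero_iff.1 hl0 with h0 | h0
          · exact h0
          · exact absurd h0 hℓw.ne'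
        have hθ0 : θ = 0 := by
          rcases div_eq_zero_iff.1 hℓz with h0 | h0
          · have : 2 * ρ ≠ 0 := by positivity
            exact (mul_eq_zero.1 h0).resolve_left this
          · exact absurd h0 hκ.ne'
        ext x
        simp only [hθ0, zero_mul, mem_setOf_eq, mem_empty_iff_false, iff_false, not_and, not_lt]
        exact fun h0 => h0
    rw [hempty, measure_empty]
    exact bot_le

end GridFree

end Summit.QuantumFields.BalabanUV.T4Continuum.ShellMeasureHeadlines
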